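import Literature.AnabelianGeometry.SemiGraphs.TemperedAnabelianThm64SubProofs
import Literature.AnabelianGeometry.SemiGraphs.TemperedAnabelianThm64SubIdentityDatum
import Literature.AnabelianGeometry.SemiGraphs.TemperedAnabelianThm64OfTowerProofs
import Literature.AnabelianGeometry.SemiGraphs.TemperedSec6OfSpecialFibreTowerEventually

/-!
# [SemiAnbd] Theorem 6.4, proof sentence 1: the two `π₁^temp`-functor clauses REDUCED to the
# profinite (étale) level — "arises geometrically ⇒ DFG-type" and the Galois diagram

Mochizuki, *Semi-graphs of anabelioids*, Publ. RIMS **42** (2006) [SemiAnbd], §6, Theorem 6.4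
(Tempered Anabelian Theorem for Hyperbolic Curves over Local Fields), author's manuscript (kurims)
statement p. 70 l. −4 – p. 71 l. 2, proof p. 71 ll. 3–4: "One verifies immediately from the definition of
the 'tempered fundamental group' that any `Π^temp_{X_K} → Π^temp_{Y_L}` that arises geometrically is of
DFG-type".  [cite: MochizukiSemiAnbd2006, Thm 6.4 pp.70-71]

PROOF-ONLY companion (abc-iut cell, L-F pack D rows F-2831 `TemperedCurve.GeometricIsDFG` = T64-L01 and
F-2832 `TemperedCurve.GeometricIsGaloisCompatible` = T64-L01b of the sub-DAG file
`TemperedAnabelianThm64Sub.lean`; seat abc-iut-L3-t12).  The two rows are the ONLY sentences of the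
printed proof that speak about the tempered-`π₁` FUNCTOR (interface datum `C : TemperedCurveHom p X Y`:
the set of dominant morphisms `X_K → Y_L` with `f ↦ π₁^temp(f)`); the tree had them at the IDENTITY datum
only (`geometricIsDFG_id_iff`, `geometricIsGaloisCompatible_id`) and refuted their bare `∀`-closures
(`not_forall_geometricIsDFG`, `not_forall_geometricIsGaloisCompatible`).  THIS FILE proves, for EVERY datum
`C` (no restriction to the identity), that both rows are consequences of — and, given the finite
generation of the discrete quotients of `Π^temp_{X_K}`, jointly EQUIVALENT to — ONE statement about the
PROFINITE COMPLETIONS `φ̂ : Π_{X_K} → Π_{Y_L}` of the homomorphisms `φ = π₁^temp(f)` (the completions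
exist and are unique: `completionExtends_holds`, `completion_unique`), namely the tree's own T64-L04
hypothesis shape `IsGaloisCompatibleOpenHatHom X Y φ̂`: "`φ̂` is open and lies over the open immersion
`G_K → G_L`, `h ↦ g⁻¹ h g`, arising from an embedding of fields `L ↪ K`".  Since `(π₁^temp(f))^∧ = π₁^ét(f)`
(p. 69 "natural injections `Π^temp_{X_K} ↪ Π_{X_K}`"; [André] §4.5), that statement is the classical
functoriality of the ÉTALE fundamental group (open image of `π₁^ét` of a dominant morphism of normal
connected schemes; the exact sequence `1 → Δ → Π → G_K → 1` is functorial over `Spec K → Spec L`) — a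
leaf OUTSIDE the tempered theory, recorded by the seat as a GAP-LEDGER row, never asserted here.

Contents (all for arbitrary `X Y : TemperedCurve p`, `C : TemperedCurveHom p X Y`):
* `galoisCompatible_of_hat` / `geometricIsGaloisCompatible_of_hat` / `…_iff_hat` — F-2832 ⟺ the Galois
  diagram for the completions (`augHat ∘ toHat = aug`; converse = `completion_galoisCompatible`);
* `closure_image_range_eq_range_hat` — the closure in `Π_{Y_L}` of the image of `Im φ` IS `Im φ̂`
  (density of `Π^temp_{X_K}` in the compact `Π_{X_K}`, `Π_{Y_L}` Hausdorff);
* `isDFGTypeHom_of_fg_quotient_of_isOpen_range_hat` — Def. 6.2 (i) for `Im φ` from (FGQ) "every discrete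
  quotient `Π^temp_{X_K}/J`, `J` open normal, is finitely generated" and "`Im φ̂` is open"; the converse
  `isOpen_range_hat_of_isDFGTypeHom` ("`Im φ̂` open" is NECESSARY); hence `geometricIsDFG_of_…` /
  `hatOpen_of_geometricIsDFG` for F-2831, and (FGQ) from the virtually-free tower input on `Π^temp_{X_K}`
  (`fg_quotient_of_tower`, via `geometricIsDFG_id_iff` ∘ `geometricIsDFG_id_of_tower`);
* `geometric_clauses_iff_hat` — (F-2831 ∧ F-2832) ⟺ (∀ f, the completion of `π₁^temp(f)` satisfies
  `IsGaloisCompatibleOpenHatHom`), given (FGQ);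
* origin level: `TemperedMorphismOrigin.temperedAnabelianTheoremHolds_of_hat_of_tower` and
  `…_of_hat_of_specialFibreTower_of_eventually_singular` — the Theorem-6.4-as-printed closers of record
  (`temperedAnabelianTheoremHolds_of_tower`, `…_of_specialFibreTower_of_eventually_singular`) with the
  binder conjuncts F-2831/F-2832 of `hfun` REPLACED by that one profinite-level leaf (`hhat`); (FGQ) for the
  source curve comes from the same tower leaves.

Honest limits: a reduction to a named leaf is not a proof of the leaf; nothing of [SemiAnbd] / [Mzk8] /
[André] / SGA1 is asserted; typed ≠ proved; nothing here takes a side on [IUTchIII] Cor. 3.12.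
-/

noncomputable section

namespace Literature.AnabelianGeometry.SemiGraphs

open _root_.Topology

namespace TemperedCurve

variable {p : ℕ} [Fact p.Prime]

/-! ### F-2832 / T64-L01b: the Galois diagram descends from the completions to `Π^temp` -/

/-- If an extension `Φ` of `φ : Π^temp_{X_K} → Π^temp_{Y_L}` to the profinite completions lies over
`G_K → G_L`, `h ↦ g⁻¹ h g`, then so does `φ` (because `Π_{X_K} → G_K` restricts to the augmentation of
`Π^temp_{X_K}`, `augHat_comp`).  Converse: `completion_galoisCompatible`.
[cite: MochizukiSemiAnbd2006, Thm 6.4 pp.70-71] -/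
theorem galoisCompatible_of_hat (X Y : TemperedCurve p) (φ : X.PiTemp →ₜ* Y.PiTemp)
    (Φ : X.PiHat →ₜ* Y.PiHat) (hΦ : ∀ x : X.PiTemp, Φ (X.toHat x) = Y.toHat (φ x)) (g : GQp p)
    (hg : ∀ z : X.PiHat, Y.augHat (Φ z) = g⁻¹ * X.augHat z * g) (x : X.PiTemp) :
    Y.aug (φ x) = g⁻¹ * X.aug x * g := by
  rw [← Y.augHat_comp, ← hΦ, hg, X.augHat_comp]

/-- **F-2832 ⟸ the profinite level.**  If, for every dominant `f`, some extension of `π₁^temp(f)` to the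
completions lies over an open immersion `G_K → G_L` arising from an embedding of fields `L ↪ K`
(`g ∈ G_{ℚ_p}`, `g(L) ⊆ K`, `h ↦ g⁻¹ h g`), then `GeometricIsGaloisCompatible C`.
[cite: MochizukiSemiAnbd2006, Thm 6.4 pp.70-71] -/
theorem geometricIsGaloisCompatible_of_hat {X Y : TemperedCurve p} (C : TemperedCurveHom p X Y)
    (hhat : ∀ f : C.DomHom, ∃ Φ : X.PiHat →ₜ* Y.PiHat,
      (∀ x : X.PiTemp, Φ (X.toHat x) = Y.toHat (C.pi1 f x)) ∧ ∃ g : GQp p,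
        IntermediateField.map (g : AlgebraicClosure ℚ_[p] →ₐ[ℚ_[p]] AlgebraicClosure ℚ_[p]) Y.K ≤ X.K ∧
          ∀ z : X.PiHat, Y.augHat (Φ z) = g⁻¹ * X.augHat z * g) :
    GeometricIsGaloisCompatible C := by
  intro f
  obtain ⟨Φ, hΦ, g, hgK, hg⟩ := hhat f
  exact ⟨g, hgK, galoisCompatible_of_hat X Y (C.pi1 f) Φ hΦ g hg⟩

/-- **F-2832 ⟹ the profinite level** (`completion_galoisCompatible` packaged with the field clause):
under `GeometricIsGaloisCompatible C`, EVERY extension of `π₁^temp(f)` to the completions lies over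
`G_K → G_L`. [cite: MochizukiSemiAnbd2006, Thm 6.4 pp.70-71] -/
theorem hat_galoisCompatible_of_geometricIsGaloisCompatible {X Y : TemperedCurve p}
    (C : TemperedCurveHom p X Y) (h : GeometricIsGaloisCompatible C) (f : C.DomHom)
    (Φ : X.PiHat →ₜ* Y.PiHat) (hΦ : ∀ x : X.PiTemp, Φ (X.toHat x) = Y.toHat (C.pi1 f x)) :
    ∃ g : GQp p,
      IntermediateField.map (g : AlgebraicClosure ℚ_[p] →ₐ[ℚ_[p]] AlgebraicClosure ℚ_[p]) Y.K ≤ X.K ∧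
        ∀ z : X.PiHat, Y.augHat (Φ z) = g⁻¹ * X.augHat z * g := by
  obtain ⟨g, hgK, hg⟩ := h f
  exact ⟨g, hgK, completion_galoisCompatible X Y (C.pi1 f) Φ hΦ g hg⟩

/-- **F-2832 ⟺ the Galois diagram at the profinite level** (extensions exist:
`completionExtends_holds`). [cite: MochizukiSemiAnbd2006, Thm 6.4 pp.70-71] -/
theorem geometricIsGaloisCompatible_iff_hat {X Y : TemperedCurve p} (C : TemperedCurveHom p X Y) :
    GeometricIsGaloisCompatible C ↔ ∀ f : C.DomHom, ∃ Φ : X.PiHat →ₜ* Y.PiHat,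
      (∀ x : X.PiTemp, Φ (X.toHat x) = Y.toHat (C.pi1 f x)) ∧ ∃ g : GQp p,
        IntermediateField.map (g : AlgebraicClosure ℚ_[p] →ₐ[ℚ_[p]] AlgebraicClosure ℚ_[p]) Y.K ≤ X.K ∧
          ∀ z : X.PiHat, Y.augHat (Φ z) = g⁻¹ * X.augHat z * g := by
  refine ⟨fun h f => ?_, geometricIsGaloisCompatible_of_hat C⟩
  obtain ⟨Φ, hΦ⟩ := completionExtends_holds X Y (C.pi1 f)
  exact ⟨Φ, hΦ, hat_galoisCompatible_of_geometricIsGaloisCompatible C h f Φ hΦ⟩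

/-! ### F-2831 / T64-L01: DFG-type ⟺ (FGQ) + "the completed homomorphism is open" -/

/-- For `φ : Π^temp_{X_K} → Π^temp_{Y_L}` with extension `Φ` to the completions, the closure in `Π_{Y_L}`
of the image of `Im φ` is exactly `Im Φ`: `Π^temp_{X_K}` is dense in the compact `Π_{X_K}` and `Π_{Y_L}`
is Hausdorff, so `Im Φ = Φ(closure Π^temp_{X_K})` is closed and contained in the closure of `Φ(Π^temp)`.
[cite: MochizukiSemiAnbd2006, §6 p.69] -/
theorem closure_image_range_eq_range_hat (X Y : TemperedCurve p) (φ : X.PiTemp →ₜ* Y.PiTemp)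
    (Φ : X.PiHat →ₜ* Y.PiHat) (hΦ : ∀ x : X.PiTemp, Φ (X.toHat x) = Y.toHat (φ x)) :
    closure (Y.toHat '' (φ.toMonoidHom.range : Set Y.PiTemp)) = Set.range Φ := by
  haveI : CompactSpace X.PiHat := X.isProfiniteCompletion_toHat.compactSpace
  haveI : T2Space Y.PiHat := Y.isProfiniteCompletion_toHat.t2Space
  have himg : Y.toHat '' (φ.toMonoidHom.range : Set Y.PiTemp) = Φ '' Set.range X.toHat := by
    rw [MonoidHom.coe_range]
    ext z
    constructor
    · rintro ⟨_, ⟨x, rfl⟩, rfl⟩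
      exact ⟨X.toHat x, ⟨x, rfl⟩, hΦ x⟩
    · rintro ⟨_, ⟨x, rfl⟩, rfl⟩
      exact ⟨φ x, ⟨x, rfl⟩, (hΦ x).symm⟩
  rw [himg]
  apply subset_antisymm
  · exact closure_minimal (Set.image_subset_range _ _) (isCompact_range Φ.continuous).isClosed
  · calc Set.range Φ = Φ '' Set.univ := Set.image_univ.symm
      _ = Φ '' closure (Set.range X.toHat) := by
          rw [X.isProfiniteCompletion_toHat.denseRange.closure_range]
      _ ⊆ closure (Φ '' Set.range X.toHat) := image_closure_subset_closure_image Φ.continuous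

/-- **"`Im φ̂` open" is NECESSARY for DFG-type**: if `φ` is of DFG-type ([SemiAnbd] Def. 6.2 (i)/(iii):
`Im φ` dense in an open subgroup of `Π_{Y_L}`), then any extension `Φ` of `φ` to the completions has open
image (that open subgroup IS `Im Φ`). [cite: MochizukiSemiAnbd2006, Def 6.2 pp.69-70] -/
theorem isOpen_range_hat_of_isDFGTypeHom (X Y : TemperedCurve p) (φ : X.PiTemp →ₜ* Y.PiTemp)
    (hφ : IsDFGTypeHom Y.toHat φ) (Φ : X.PiHat →ₜ* Y.PiHat)
    (hΦ : ∀ x : X.PiTemp, Φ (X.toHat x) = Y.toHat (φ x)) : IsOpen (Set.range Φ) := by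
  obtain ⟨⟨U, hUo, hU⟩, -⟩ := hφ
  rw [← closure_image_range_eq_range_hat X Y φ Φ hΦ, hU]
  exact hUo

/-- The image of `Π^temp_{X_K}` in a discrete quotient `Π^temp_{Y_L}/J` along `φ` is finitely generated
as soon as `Π^temp_{X_K}/φ⁻¹(J)` is (private helper). [folklore] -/
private theorem fg_range_mk'_comp_of_fg_quotient (X Y : TemperedCurve p) (φ : X.PiTemp →ₜ* Y.PiTemp)
    (J : OpenNormalSubgroup Y.PiTemp)
    (hfg : Group.FG (X.PiTemp ⧸ (J.toSubgroup.comap φ.toMonoidHom))) :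
    ((QuotientGroup.mk' J.toSubgroup).comp φ.toMonoidHom).range.FG := by
  have hker : J.toSubgroup.comap φ.toMonoidHom ≤ ((QuotientGroup.mk' J.toSubgroup).comp φ.toMonoidHom).ker :=
    fun x hx => by
      rw [MonoidHom.mem_ker, MonoidHom.comp_apply, QuotientGroup.mk'_apply, QuotientGroup.eq_one_iff]
      exact hx
  have hcomp : (QuotientGroup.lift _ _ hker).comp (QuotientGroup.mk' (J.toSubgroup.comap φ.toMonoidHom)) =
      (QuotientGroup.mk' J.toSubgroup).comp φ.toMonoidHom :=
    MonoidHom.ext fun _ => rfl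
  have hrange : ((QuotientGroup.mk' J.toSubgroup).comp φ.toMonoidHom).range =
      (QuotientGroup.lift _ _ hker).range := by
    conv_lhs => rw [← hcomp]
    rw [MonoidHom.range_comp, MonoidHom.range_eq_top.2 (QuotientGroup.mk'_surjective _),
      ← MonoidHom.range_eq_map]
  rw [← Group.fg_iff_subgroup_fg, hrange]
  haveI := hfg
  infer_instance

/-- **F-2831 ⟸ (FGQ) + open completed image**, for one homomorphism: if every discrete quotient
`Π^temp_{X_K}/J` (`J` open normal) is finitely generated and an extension `Φ` of `φ` to the completions has
OPEN image, then `φ` is of DFG-type ([SemiAnbd] Def. 6.2 (i)/(iii)): `Im φ` is dense in the open subgroup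
`Im Φ` of `Π_{Y_L}` (`closure_image_range_eq_range_hat`), and its image in `Π^temp_{Y_L}/J` is a quotient
of `Π^temp_{X_K}/φ⁻¹(J)`. [cite: MochizukiSemiAnbd2006, Def 6.2 pp.69-70] -/
theorem isDFGTypeHom_of_fg_quotient_of_isOpen_range_hat (X Y : TemperedCurve p)
    (hfg : ∀ J : OpenNormalSubgroup X.PiTemp, Group.FG (X.PiTemp ⧸ J.toSubgroup))
    (φ : X.PiTemp →ₜ* Y.PiTemp) (Φ : X.PiHat →ₜ* Y.PiHat)
    (hΦ : ∀ x : X.PiTemp, Φ (X.toHat x) = Y.toHat (φ x)) (hopen : IsOpen (Set.range Φ)) :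
    IsDFGTypeHom Y.toHat φ := by
  refine ⟨⟨Φ.toMonoidHom.range, ?_, ?_⟩, fun J => ?_⟩
  · rw [MonoidHom.coe_range]
    exact hopen
  · rw [MonoidHom.coe_range Φ.toMonoidHom]
    exact closure_image_range_eq_range_hat X Y φ Φ hΦ
  · rw [MonoidHom.map_range]
    let K : OpenNormalSubgroup X.PiTemp :=
      { toOpenSubgroup := J.toOpenSubgroup.comap φ.toMonoidHom φ.continuous
        isNormal' := by
          change (J.toSubgroup.comap φ.toMonoidHom).Normal
          infer_instance }
    exact fg_range_mk'_comp_of_fg_quotient X Y φ J (hfg K)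

/-- **F-2831 ⟺**, for one homomorphism, given (FGQ): `φ` is of DFG-type iff some (equivalently — by
`completion_unique` — every) extension of `φ` to the completions has open image.
[cite: MochizukiSemiAnbd2006, Def 6.2 pp.69-70] -/
theorem isDFGTypeHom_iff_isOpen_range_hat (X Y : TemperedCurve p)
    (hfg : ∀ J : OpenNormalSubgroup X.PiTemp, Group.FG (X.PiTemp ⧸ J.toSubgroup))
    (φ : X.PiTemp →ₜ* Y.PiTemp) (Φ : X.PiHat →ₜ* Y.PiHat)
    (hΦ : ∀ x : X.PiTemp, Φ (X.toHat x) = Y.toHat (φ x)) :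
    IsDFGTypeHom Y.toHat φ ↔ IsOpen (Set.range Φ) :=
  ⟨fun h => isOpen_range_hat_of_isDFGTypeHom X Y φ h Φ hΦ,
    isDFGTypeHom_of_fg_quotient_of_isOpen_range_hat X Y hfg φ Φ hΦ⟩

/-- **(FGQ) from the tower input** ([André] §4.5: a neighbourhood basis of `1` in `Π^temp_{X_K}` of open
normal `N` with `Π^temp/N` virtually free of finite rank): every discrete quotient `Π^temp_{X_K}/J` is
finitely generated (`geometricIsDFG_id_iff` ∘ `geometricIsDFG_id_of_tower`).
[cite: MochizukiSemiAnbd2006, Thm 6.4 proof p.71] -/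
theorem fg_quotient_of_tower (X : TemperedCurve p)
    (htower₀ : ∀ U ∈ 𝓝 (1 : X.PiTemp), ∃ N : OpenNormalSubgroup X.PiTemp, (N : Set X.PiTemp) ⊆ U ∧
      ∃ (G : Subgroup (X.PiTemp ⧸ N.toSubgroup)) (_ : IsFreeGroup G), G.Normal ∧ G.FiniteIndex ∧
        Finite (IsFreeGroup.Generators G) ∧ ∃ a ∈ G, ∃ b ∈ G, a * b ≠ b * a)
    (J : OpenNormalSubgroup X.PiTemp) : Group.FG (X.PiTemp ⧸ J.toSubgroup) :=
  (geometricIsDFG_id_iff X).mp (geometricIsDFG_id_of_tower X htower₀) J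

/-- **F-2831 `GeometricIsDFG C` ⟸ (FGQ) + "every `(π₁^temp f)^∧` is open"**, for every datum `C`.
[cite: MochizukiSemiAnbd2006, Thm 6.4 proof p.71] -/
theorem geometricIsDFG_of_fg_quotient_of_hatOpen {X Y : TemperedCurve p} (C : TemperedCurveHom p X Y)
    (hfg : ∀ J : OpenNormalSubgroup X.PiTemp, Group.FG (X.PiTemp ⧸ J.toSubgroup))
    (hopen : ∀ f : C.DomHom, ∃ Φ : X.PiHat →ₜ* Y.PiHat,
      (∀ x : X.PiTemp, Φ (X.toHat x) = Y.toHat (C.pi1 f x)) ∧ IsOpen (Set.range Φ)) :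
    GeometricIsDFG C := by
  intro f
  obtain ⟨Φ, hΦ, hop⟩ := hopen f
  exact isDFGTypeHom_of_fg_quotient_of_isOpen_range_hat X Y hfg (C.pi1 f) Φ hΦ hop

/-- **F-2831 `GeometricIsDFG C` ⟸ the tower input on `Π^temp_{X_K}` + "every `(π₁^temp f)^∧` is open"**.
[cite: MochizukiSemiAnbd2006, Thm 6.4 proof p.71] -/
theorem geometricIsDFG_of_tower_of_hatOpen {X Y : TemperedCurve p} (C : TemperedCurveHom p X Y)
    (htower₀ : ∀ U ∈ 𝓝 (1 : X.PiTemp), ∃ N : OpenNormalSubgroup X.PiTemp, (N : Set X.PiTemp) ⊆ U ∧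
      ∃ (G : Subgroup (X.PiTemp ⧸ N.toSubgroup)) (_ : IsFreeGroup G), G.Normal ∧ G.FiniteIndex ∧
        Finite (IsFreeGroup.Generators G) ∧ ∃ a ∈ G, ∃ b ∈ G, a * b ≠ b * a)
    (hopen : ∀ f : C.DomHom, ∃ Φ : X.PiHat →ₜ* Y.PiHat,
      (∀ x : X.PiTemp, Φ (X.toHat x) = Y.toHat (C.pi1 f x)) ∧ IsOpen (Set.range Φ)) :
    GeometricIsDFG C :=
  geometricIsDFG_of_fg_quotient_of_hatOpen C (fg_quotient_of_tower X htower₀) hopen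

/-- **F-2831 ⟹ "every `(π₁^temp f)^∧` is open"** (no (FGQ) needed in this direction).
[cite: MochizukiSemiAnbd2006, Thm 6.4 proof p.71] -/
theorem hatOpen_of_geometricIsDFG {X Y : TemperedCurve p} (C : TemperedCurveHom p X Y)
    (h : GeometricIsDFG C) (f : C.DomHom) (Φ : X.PiHat →ₜ* Y.PiHat)
    (hΦ : ∀ x : X.PiTemp, Φ (X.toHat x) = Y.toHat (C.pi1 f x)) : IsOpen (Set.range Φ) :=
  isOpen_range_hat_of_isDFGTypeHom X Y (C.pi1 f) (h f) Φ hΦ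

/-! ### Both clauses ⟺ ONE profinite-level statement: `IsGaloisCompatibleOpenHatHom` for `(π₁^temp f)^∧` -/

/-- **F-2831 ∧ F-2832 ⟸ (FGQ) + the profinite leaf**: if every discrete quotient of `Π^temp_{X_K}` is
finitely generated and, for every dominant `f`, some extension `Φ` of `π₁^temp(f)` to the completions is
open and lies over `G_K → G_L` from `L ↪ K` (`IsGaloisCompatibleOpenHatHom X Y Φ`, the T64-L04 shape),
then `GeometricIsDFG C ∧ GeometricIsGaloisCompatible C`. [cite: MochizukiSemiAnbd2006, Thm 6.4 pp.70-71] -/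
theorem geometric_clauses_of_hat {X Y : TemperedCurve p} (C : TemperedCurveHom p X Y)
    (hfg : ∀ J : OpenNormalSubgroup X.PiTemp, Group.FG (X.PiTemp ⧸ J.toSubgroup))
    (hhat : ∀ f : C.DomHom, ∃ Φ : X.PiHat →ₜ* Y.PiHat,
      (∀ x : X.PiTemp, Φ (X.toHat x) = Y.toHat (C.pi1 f x)) ∧ IsGaloisCompatibleOpenHatHom X Y Φ) :
    GeometricIsDFG C ∧ GeometricIsGaloisCompatible C := by
  refine ⟨geometricIsDFG_of_fg_quotient_of_hatOpen C hfg fun f => ?_,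
    geometricIsGaloisCompatible_of_hat C fun f => ?_⟩
  · obtain ⟨Φ, hΦ, hop, -⟩ := hhat f
    exact ⟨Φ, hΦ, hop⟩
  · obtain ⟨Φ, hΦ, -, hg⟩ := hhat f
    exact ⟨Φ, hΦ, hg⟩

/-- **F-2831 ∧ F-2832 ⟹ the profinite leaf**: under both clauses, EVERY extension of every `π₁^temp(f)`
to the completions satisfies `IsGaloisCompatibleOpenHatHom`. [cite: MochizukiSemiAnbd2006, Thm 6.4 pp.70-71] -/
theorem hat_of_geometric_clauses {X Y : TemperedCurve p} (C : TemperedCurveHom p X Y)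
    (h01 : GeometricIsDFG C) (h01b : GeometricIsGaloisCompatible C) (f : C.DomHom)
    (Φ : X.PiHat →ₜ* Y.PiHat) (hΦ : ∀ x : X.PiTemp, Φ (X.toHat x) = Y.toHat (C.pi1 f x)) :
    IsGaloisCompatibleOpenHatHom X Y Φ :=
  ⟨hatOpen_of_geometricIsDFG C h01 f Φ hΦ,
    hat_galoisCompatible_of_geometricIsGaloisCompatible C h01b f Φ hΦ⟩

/-- **F-2831 ∧ F-2832 ⟺ the profinite leaf, given (FGQ)** — the two tempered-`π₁`-functor sentences of
the printed proof of Thm. 6.4 are, over the interface, EXACTLY the statement that the completions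
`(π₁^temp f)^∧ : Π_{X_K} → Π_{Y_L}` are open and lie over `G_K → G_L` (i.e. the functoriality of the étale
fundamental group, `(π₁^temp)^∧ = π₁^ét`, p. 69 / [André] §4.5). [cite: MochizukiSemiAnbd2006, Thm 6.4 pp.70-71] -/
theorem geometric_clauses_iff_hat {X Y : TemperedCurve p} (C : TemperedCurveHom p X Y)
    (hfg : ∀ J : OpenNormalSubgroup X.PiTemp, Group.FG (X.PiTemp ⧸ J.toSubgroup)) :
    (GeometricIsDFG C ∧ GeometricIsGaloisCompatible C) ↔ ∀ f : C.DomHom, ∃ Φ : X.PiHat →ₜ* Y.PiHat,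
      (∀ x : X.PiTemp, Φ (X.toHat x) = Y.toHat (C.pi1 f x)) ∧ IsGaloisCompatibleOpenHatHom X Y Φ := by
  refine ⟨fun h f => ?_, geometric_clauses_of_hat C hfg⟩
  obtain ⟨Φ, hΦ⟩ := completionExtends_holds X Y (C.pi1 f)
  exact ⟨Φ, hΦ, hat_of_geometric_clauses C h.1 h.2 f Φ hΦ⟩

/-- The same equivalence with (FGQ) supplied by the tower input on `Π^temp_{X_K}`.
[cite: MochizukiSemiAnbd2006, Thm 6.4 pp.70-71] -/
theorem geometric_clauses_iff_hat_of_tower {X Y : TemperedCurve p} (C : TemperedCurveHom p X Y)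
    (htower₀ : ∀ U ∈ 𝓝 (1 : X.PiTemp), ∃ N : OpenNormalSubgroup X.PiTemp, (N : Set X.PiTemp) ⊆ U ∧
      ∃ (G : Subgroup (X.PiTemp ⧸ N.toSubgroup)) (_ : IsFreeGroup G), G.Normal ∧ G.FiniteIndex ∧
        Finite (IsFreeGroup.Generators G) ∧ ∃ a ∈ G, ∃ b ∈ G, a * b ≠ b * a) :
    (GeometricIsDFG C ∧ GeometricIsGaloisCompatible C) ↔ ∀ f : C.DomHom, ∃ Φ : X.PiHat →ₜ* Y.PiHat,
      (∀ x : X.PiTemp, Φ (X.toHat x) = Y.toHat (C.pi1 f x)) ∧ IsGaloisCompatibleOpenHatHom X Y Φ :=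
  geometric_clauses_iff_hat C (fg_quotient_of_tower X htower₀)

end TemperedCurve

/-! ### Theorem 6.4 as printed: the closers of record re-knit over the profinite leaf -/

namespace TemperedMorphismOrigin

variable {p : ℕ} [Fact p.Prime]

/-- **[SemiAnbd] Theorem 6.4 as printed** (`Ω.TemperedAnabelianTheoremHolds`, row F-1693) from: (hhat) for
certified dominant morphisms, the completions of `π₁^temp(f)` are open and lie over `G_K → G_L` (the étale
functoriality leaf — REPLACING the binders F-2831/F-2832 of `temperedAnabelianTheoremHolds_of_tower`);
(h04) [Mzk8] Thm. 1.2 read on `Π^temp ↪ Π` (`ProfiniteAnabelianTheorem`, F-2836); (htw) for every certified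
curve, `IsTempered` with the virtually-free tower input ([André] §4.5).
[cite: MochizukiSemiAnbd2006, Thm 6.4 pp.70-71] -/
theorem temperedAnabelianTheoremHolds_of_hat_of_tower (Ω : TemperedMorphismOrigin p)
    (hhat : ∀ (X Y : TemperedCurve p) (C : TemperedCurveHom p X Y), Ω.IsHyperbolicCurveOrigin X →
      Ω.IsHyperbolicCurveOrigin Y → Ω.IsDomHomOrigin C → ∀ f : C.DomHom, ∃ Φ : X.PiHat →ₜ* Y.PiHat,
        (∀ x : X.PiTemp, Φ (X.toHat x) = Y.toHat (C.pi1 f x)) ∧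
          TemperedCurve.IsGaloisCompatibleOpenHatHom X Y Φ)
    (h04 : ∀ (X Y : TemperedCurve p) (C : TemperedCurveHom p X Y), Ω.IsHyperbolicCurveOrigin X →
      Ω.IsHyperbolicCurveOrigin Y → Ω.IsDomHomOrigin C → TemperedCurve.ProfiniteAnabelianTheorem C)
    (htw : ∀ Y : TemperedCurve p, Ω.IsHyperbolicCurveOrigin Y → IsTempered Y.PiTemp ∧
      ∀ U ∈ 𝓝 (1 : Y.PiTemp), ∃ N : OpenNormalSubgroup Y.PiTemp, (N : Set Y.PiTemp) ⊆ U ∧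
        ∃ (G : Subgroup (Y.PiTemp ⧸ N.toSubgroup)) (_ : IsFreeGroup G), G.Normal ∧ G.FiniteIndex ∧
          Finite (IsFreeGroup.Generators G) ∧ ∃ a ∈ G, ∃ b ∈ G, a * b ≠ b * a) :
    Ω.TemperedAnabelianTheoremHolds :=
  Ω.temperedAnabelianTheoremHolds_of_tower (fun X Y C hX hY hC =>
    have hcl := TemperedCurve.geometric_clauses_of_hat C
      (TemperedCurve.fg_quotient_of_tower X (htw X hX).2) (hhat X Y C hX hY hC)
    ⟨hcl.1, hcl.2, h04 X Y C hX hY hC⟩) htw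

/-- **[SemiAnbd] Theorem 6.4 as printed** from (hhat) the étale functoriality leaf, (h04) [Mzk8] Thm. 1.2
(F-2836), and the origin-level leaves (L-η′) `GroupLevelData`, (L-Ex310) the special-fibre tower with
(P0)/(h1′), (L-sing′) eventually finite coherent singular fibres — the closer of record
`temperedAnabelianTheoremHolds_of_specialFibreTower_of_eventually_singular` with the F-2831/F-2832 binders
replaced. [cite: MochizukiSemiAnbd2006, Thm 6.4 pp.70-71] -/
theorem temperedAnabelianTheoremHolds_of_hat_of_specialFibreTower_of_eventually_singular
    (Ω : TemperedMorphismOrigin p)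
    (hhat : ∀ (X Y : TemperedCurve p) (C : TemperedCurveHom p X Y), Ω.IsHyperbolicCurveOrigin X →
      Ω.IsHyperbolicCurveOrigin Y → Ω.IsDomHomOrigin C → ∀ f : C.DomHom, ∃ Φ : X.PiHat →ₜ* Y.PiHat,
        (∀ x : X.PiTemp, Φ (X.toHat x) = Y.toHat (C.pi1 f x)) ∧
          TemperedCurve.IsGaloisCompatibleOpenHatHom X Y Φ)
    (h04 : ∀ (X Y : TemperedCurve p) (C : TemperedCurveHom p X Y), Ω.IsHyperbolicCurveOrigin X →
      Ω.IsHyperbolicCurveOrigin Y → Ω.IsDomHomOrigin C → TemperedCurve.ProfiniteAnabelianTheorem C)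
    (hEx : ∀ X : TemperedCurve p, Ω.IsHyperbolicCurveOrigin X →
      Nonempty X.GroupLevelData ∧ ∃ T : SpecialFibreTower X.DeltaTemp,
        (∀ i, ((T.admKer i).map X.DeltaTemp.subtype).Normal) ∧
        (∀ U ∈ 𝓝 (1 : X.DeltaTemp), ∀ i₀ : ℕ, ∃ i, i₀ ≤ i ∧ ∃ V ∈ 𝓝 (1 : (T.chart i).G),
          ∀ n : T.N i, T.adm i n ∈ V → (n : X.DeltaTemp) ∈ U) ∧
        ∃ i₀ : ℕ, (∀ i, i₀ ≤ i → Finite (T.Gc i).graph.Vertex) ∧ (∀ i, i₀ ≤ i → Finite (T.Gc i).graph.Edge) ∧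
          (∀ i, i₀ ≤ i → (T.Gc i).IsCoherent) ∧
          (∀ i, i₀ ≤ i → ∃ e : (T.Gc i).graph.Edge, (T.Gc i).graph.IsClosedEdge e)) :
    Ω.TemperedAnabelianTheoremHolds :=
  Ω.temperedAnabelianTheoremHolds_of_hat_of_tower hhat h04 fun Y hY =>
    Y.isTempered_and_tower_of_specialFibreTower_of_eventually_singular (hEx Y hY)

end TemperedMorphismOrigin

end Literature.AnabelianGeometry.SemiGraphs

end
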